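import Summits.ValiantsHypothesis.ValiantsHypothesis.Theorems.SymPencilPerFourCoordinateRadical
import Summits.ValiantsHypothesis.ValiantsHypothesis.Theorems.SymPencilBoxFourEquality

/-!
# Route `SymPencil` — two `5`-dimensional singular subspaces of `per_4` with per-base-point AND
# per-direction families of FOUR squares (`--supports` stmt-ValiantsHypothesis-5674
# `SdcSuperquadratic`; negative calibration for the size-`27` table, cell `(11, 5, 4)`)

At size `m = 27` the kernel-package cell `(r, dim V, d) = (11, 5, 4)` asks for a `5`-dimensional
`V ⊆ Sing Z(per_4)` carrying a joint bilinear family of four squares as the `s²`-coefficients of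
`per_4 (u + s y)`.  Every landed `V`-side tool (`SymPencilPerFourHessianRowControl`,
`…HessianMinors`, `…SixDimNoJointFamily.false_of_families_six`, …) uses only the two WEAKER
consequences: the per-base-point family (for each `u`, `4` squares of linear functionals of `y`)
and the per-direction family (for each `y`, `4` squares of linear functionals of `u`, i.e.
`rank Hess per_4 (y) ≤ 4`).  At dimension `5` these do NOT suffice:

**Theorem** (`exists_families_five_cross`, `exists_families_five_rows`).  Each of
`V₅× = span {E₀₀, E₀₁, E₀₂, E₁₀, E₂₀}` (inside the cross `row 0 ∪ column 0`) and
`V₅⁼ = span {E₀₀, E₀₁, E₀₂, E₁₀, E₁₁}` (inside rows `0, 1`) has all `3 × 3` subpermanents zero,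
dimension `5`, and carries BOTH families with four squares (characteristic `0`).  With
`π_{jl} = u_{2j} u_{3l} + u_{2l} u_{3j}`: on `V₅×` (`row 0 = (a₀,a₁,a₂,0)`, `y₁₀ = p`, `y₂₀ = q`) the
`s²`-coefficient is `u₃₃ · w + v₃ n₃`, `w = p(a₂u₂₁ + a₁u₂₂) + q(a₂u₁₁ + a₁u₁₂)`,
`v₃ = p u₂₃ + q u₁₃`, `n₃ = a₂u₃₁ + a₁u₃₂` — bilinear in `((p,q), (a₁,a₂))` for fixed `u`; on `V₅⁼`
(`row 1 = (b₀,b₁,0,0)`) it is `(a₀b₁ + a₁b₀) π₂₃ + a₂b₀ π₁₃ + a₂b₁ π₀₃ = u₃₃ (z · u₂) + u₂₃ (z · u₃)`,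
`z = (a₂b₁, a₂b₀, a₀b₁ + a₁b₀)`; each is `¼(x+y)² − ¼(x−y)² + ¼(x′+y′)² − ¼(x′−y′)²` with linear
`x, y, x′, y′`.  (An exact census of the coordinate singular `5`-spaces — five orbit classes —
shows these are the only two classes with `rank Hess ≤ 4`; `Cruxes/SdcSuperquadratic/TORIC-SIX.md`
§X.)

**Corollary** (`not_false_of_families_five`).  The dimension-`5` / four-square analogue of
`SymPencilPerFourSixDimNoJointFamily.false_of_families_six` is FALSE: the `(11, 5, 4)` cell is
invisible to per-base-point / per-direction counting and can only be decided by the JOINT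
(bilinear) structure of the family or by pencil input.

Honest framing: a calibration (negative knowledge); `27 ≤ sdc(per₄) ≤ 29` unchanged, the crux
`SdcSuperquadratic` and `VP ≠ VNP` untouched.  No definitions, no named facts. [folklore]
-/

noncomputable section

-- single-conjunct layout: Sub = Summit, duplicated namespace component intended
set_option linter.dupNamespace false

namespace Summit.ValiantsHypothesis.ValiantsHypothesis.Theorems.SymPencilPerFourFiveDimFamilies

open MvPolynomial Module
open Literature.Computability.AlgebraicComplexity
open Summit.ValiantsHypothesis.ValiantsHypothesis.Theorems.SymPencilBoxFourEquality

variable {K : Type*} [Field K]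

/-- **The cross-type `5`-space `V₅× = span {E₀₀, E₀₁, E₀₂, E₁₀, E₂₀}`** is singular, `5`-dimensional,
and carries per-base-point and per-direction families of four squares. [folklore] -/
theorem exists_families_five_cross [CharZero K] :
    ∃ W : Submodule K (Fin 4 × Fin 4 → K),
      (∀ x ∈ W, ∀ (r c : Fin 3 → Fin 4), Function.Injective r → Function.Injective c →
        ((Matrix.of fun i j => x (i, j)).submatrix r c).permanent = 0) ∧
      finrank K W = 5 ∧
      (∀ u : Fin 4 × Fin 4 → K, ∃ (c : Fin 4 → K) (Λ : Fin 4 → ((Fin 4 × Fin 4 → K) →ₗ[K] K)),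
        ∀ y ∈ W, ∃ e₀ e₁ : K, ∀ s : K,
          eval (u + s • y) (perPoly (Fin 4) K) = e₀ + s * e₁ + s ^ 2 * ∑ k, c k * (Λ k y) ^ 2) ∧
      (∀ y ∈ W, ∃ (c : Fin 4 → K) (Λ : Fin 4 → ((Fin 4 × Fin 4 → K) →ₗ[K] K)),
        ∀ u : Fin 4 × Fin 4 → K, ∃ e₀ e₁ : K, ∀ s : K,
          eval (u + s • y) (perPoly (Fin 4) K) = e₀ + s * e₁ + s ^ 2 * ∑ k, c k * (Λ k u) ^ 2) := by
  classical
  have hcases : ∀ i : Fin 4, i = 0 ∨ i = 1 ∨ i = 2 ∨ i = 3 := by decide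
  -- the parametrisation `(a, p, q) ↦ (row 0 = (a 0, a 1, a 2, 0), y₁₀ = p, y₂₀ = q, 0 elsewhere)`
  let F : (Fin 3 → K) × K × K → (Fin 4 × Fin 4 → K) := fun g z =>
    if z.1 = 0 then (if z.2 = 0 then g.1 0 else if z.2 = 1 then g.1 1 else if z.2 = 2 then g.1 2 else 0)
    else if z.2 = 0 then (if z.1 = 1 then g.2.1 else if z.1 = 2 then g.2.2 else 0)
    else 0
  have hF : ∀ g z, F g z =
    (if z.1 = 0 then (if z.2 = 0 then g.1 0 else if z.2 = 1 then g.1 1 else if z.2 = 2 then g.1 2 else 0)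
    else if z.2 = 0 then (if z.1 = 1 then g.2.1 else if z.1 = 2 then g.2.2 else 0)
    else 0) := fun _ _ => rfl
  let ψ : ((Fin 3 → K) × K × K) →ₗ[K] (Fin 4 × Fin 4 → K) :=
    { toFun := F
      map_add' := fun g g' => by
        funext z; simp only [hF, Prod.fst_add, Prod.snd_add, Pi.add_apply]
        split_ifs <;> ring
      map_smul' := fun r g => by
        funext z; simp only [hF, Prod.smul_fst, Prod.smul_snd, Pi.smul_apply, smul_eq_mul,
          RingHom.id_apply]
        split_ifs <;> ring }
  have hψ : ∀ (a : Fin 3 → K) (p q : K) (i j : Fin 4), ψ (a, p, q) (i, j) =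
      (if i = 0 then (if j = 0 then a 0 else if j = 1 then a 1 else if j = 2 then a 2 else 0)
        else if j = 0 then (if i = 1 then p else if i = 2 then q else 0) else 0) :=
    fun _ _ _ _ _ => rfl
  obtain ⟨f10, f20, f21, f30, f31, f32⟩ : (((1 : Fin 4) = 0) = False) ∧ (((2 : Fin 4) = 0) = False) ∧
      (((2 : Fin 4) = 1) = False) ∧ (((3 : Fin 4) = 0) = False) ∧ (((3 : Fin 4) = 1) = False) ∧
      (((3 : Fin 4) = 2) = False) := by
    refine ⟨?_, ?_, ?_, ?_, ?_, ?_⟩ <;> decide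
  have h00 : ∀ (a : Fin 3 → K) (p q : K), ψ (a, p, q) (0, 0) = a 0 := fun a p q => by
    rw [hψ]; simp
  have h01 : ∀ (a : Fin 3 → K) (p q : K), ψ (a, p, q) (0, 1) = a 1 := fun a p q => by
    rw [hψ]; simp [f10]
  have h02 : ∀ (a : Fin 3 → K) (p q : K), ψ (a, p, q) (0, 2) = a 2 := fun a p q => by
    rw [hψ]; simp [f20, f21]
  have h03 : ∀ (a : Fin 3 → K) (p q : K), ψ (a, p, q) (0, 3) = 0 := fun a p q => by
    rw [hψ]; simp [f30, f31, f32]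
  have h10 : ∀ (a : Fin 3 → K) (p q : K), ψ (a, p, q) (1, 0) = p := fun a p q => by
    rw [hψ]; simp [f10]
  have h20 : ∀ (a : Fin 3 → K) (p q : K), ψ (a, p, q) (2, 0) = q := fun a p q => by
    rw [hψ]; simp [f20, f21]
  have h1 : ∀ (a : Fin 3 → K) (p q : K) (j : Fin 4), j ≠ 0 → ψ (a, p, q) (1, j) = 0 :=
    fun a p q j hj => by rw [hψ]; simp [hj, f10]
  have h2 : ∀ (a : Fin 3 → K) (p q : K) (j : Fin 4), j ≠ 0 → ψ (a, p, q) (2, j) = 0 :=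
    fun a p q j hj => by rw [hψ]; simp [hj, f20]
  have h3 : ∀ (a : Fin 3 → K) (p q : K) (j : Fin 4), ψ (a, p, q) (3, j) = 0 := fun a p q j => by
    rw [hψ]; simp [f30, f31, f32]
  have h11 : ∀ (a : Fin 3 → K) (p q : K), ψ (a, p, q) (1, 1) = 0 := fun a p q => h1 a p q 1 (by decide)
  have h12 : ∀ (a : Fin 3 → K) (p q : K), ψ (a, p, q) (1, 2) = 0 := fun a p q => h1 a p q 2 (by decide)
  have h13 : ∀ (a : Fin 3 → K) (p q : K), ψ (a, p, q) (1, 3) = 0 := fun a p q => h1 a p q 3 (by decide)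
  have h21 : ∀ (a : Fin 3 → K) (p q : K), ψ (a, p, q) (2, 1) = 0 := fun a p q => h2 a p q 1 (by decide)
  have h22 : ∀ (a : Fin 3 → K) (p q : K), ψ (a, p, q) (2, 2) = 0 := fun a p q => h2 a p q 2 (by decide)
  have h23 : ∀ (a : Fin 3 → K) (p q : K), ψ (a, p, q) (2, 3) = 0 := fun a p q => h2 a p q 3 (by decide)
  let W : Submodule K (Fin 4 × Fin 4 → K) := LinearMap.range ψ
  have hmem : ∀ x ∈ W, ∃ (a : Fin 3 → K) (p q : K), x = ψ (a, p, q) := by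
    rintro _ ⟨⟨a, p, q⟩, rfl⟩
    exact ⟨a, p, q, rfl⟩
  -- `succAbove` on `Fin 4`
  obtain ⟨e00, e01, e02, e10, e11, e12, e20, e21, e22, e30, e31, e32⟩ :
      (0 : Fin 4).succAbove 0 = 1 ∧ (0 : Fin 4).succAbove 1 = 2 ∧ (0 : Fin 4).succAbove 2 = 3 ∧
      (1 : Fin 4).succAbove 0 = 0 ∧ (1 : Fin 4).succAbove 1 = 2 ∧ (1 : Fin 4).succAbove 2 = 3 ∧
      (2 : Fin 4).succAbove 0 = 0 ∧ (2 : Fin 4).succAbove 1 = 1 ∧ (2 : Fin 4).succAbove 2 = 3 ∧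
      (3 : Fin 4).succAbove 0 = 0 ∧ (3 : Fin 4).succAbove 1 = 1 ∧ (3 : Fin 4).succAbove 2 = 2 := by
    decide
  -- singular
  have hSing : ∀ x ∈ W, ∀ (r c : Fin 3 → Fin 4), Function.Injective r → Function.Injective c →
      ((Matrix.of fun i j => x (i, j)).submatrix r c).permanent = 0 := by
    intro x hx
    obtain ⟨a, p, q, rfl⟩ := hmem x hx
    refine subperm_vanish_inj_of_succAbove _ fun r c => ?_
    rcases hcases r with rfl | rfl | rfl | rfl <;> rcases hcases c with rfl | rfl | rfl | rfl <;>
      · simp only [Matrix.permanent_fin_three_row, Matrix.submatrix_apply, Matrix.of_apply,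
          e00, e01, e02, e10, e11, e12, e20, e21, e22, e30, e31, e32,
          h00, h01, h02, h03, h10, h11, h12, h13, h20, h21, h22, h23, h3]
        ring
  -- dimension `5`
  have hinj : Function.Injective ψ := by
    refine (injective_iff_map_eq_zero ψ).2 fun g hg => ?_
    obtain ⟨a, p, q⟩ := g
    have ha0 : a 0 = 0 := by have h := congr_fun hg (0, 0); rwa [h00] at h
    have ha1 : a 1 = 0 := by have h := congr_fun hg (0, 1); rwa [h01] at h
    have ha2 : a 2 = 0 := by have h := congr_fun hg (0, 2); rwa [h02] at h
    have ha : a = 0 := by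
      funext j
      rcases (by decide : ∀ j : Fin 3, j = 0 ∨ j = 1 ∨ j = 2) j with rfl | rfl | rfl <;> assumption
    have hp : p = 0 := by have h := congr_fun hg (1, 0); rwa [h10] at h
    have hq : q = 0 := by have h := congr_fun hg (2, 0); rwa [h20] at h
    rw [ha, hp, hq]; rfl
  have hW5 : finrank K W = 5 := by
    rw [LinearMap.finrank_range_of_inj hinj, Module.finrank_prod, Module.finrank_prod,
      finrank_fintype_fun_eq_card, Fintype.card_fin, Module.finrank_self]
  -- the `s¹`-coefficient (first-order term) along `y = ψ (a, p, q)`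
  let D1 : (Fin 4 × Fin 4 → K) → (Fin 3 → K) → K → K → K := fun u a p q =>
    a 0 * ((Matrix.of fun i j => u (i, j)).submatrix (0 : Fin 4).succAbove
        (0 : Fin 4).succAbove).permanent +
      a 1 * ((Matrix.of fun i j => u (i, j)).submatrix (0 : Fin 4).succAbove
        (1 : Fin 4).succAbove).permanent +
      a 2 * ((Matrix.of fun i j => u (i, j)).submatrix (0 : Fin 4).succAbove
        (2 : Fin 4).succAbove).permanent +
      p * ((Matrix.of fun i j => u (i, j)).submatrix (1 : Fin 4).succAbove
        (0 : Fin 4).succAbove).permanent +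
      q * ((Matrix.of fun i j => u (i, j)).submatrix (2 : Fin 4).succAbove
        (0 : Fin 4).succAbove).permanent
  refine ⟨W, hSing, hW5, fun u => ?_, fun x hx => ?_⟩
  · -- per-base-point family: `q = p₁ L₁(a) + p₂ L₂(a)`
    refine ⟨![4⁻¹, -4⁻¹, 4⁻¹, -4⁻¹],
      ![LinearMap.proj (1, 0) +
          ((u (2, 1) * u (3, 3) + u (2, 3) * u (3, 1)) • LinearMap.proj (0, 2) +
            (u (2, 2) * u (3, 3) + u (2, 3) * u (3, 2)) • LinearMap.proj (0, 1)),
        LinearMap.proj (1, 0) -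
          ((u (2, 1) * u (3, 3) + u (2, 3) * u (3, 1)) • LinearMap.proj (0, 2) +
            (u (2, 2) * u (3, 3) + u (2, 3) * u (3, 2)) • LinearMap.proj (0, 1)),
        LinearMap.proj (2, 0) +
          ((u (1, 1) * u (3, 3) + u (1, 3) * u (3, 1)) • LinearMap.proj (0, 2) +
            (u (1, 2) * u (3, 3) + u (1, 3) * u (3, 2)) • LinearMap.proj (0, 1)),
        LinearMap.proj (2, 0) -
          ((u (1, 1) * u (3, 3) + u (1, 3) * u (3, 1)) • LinearMap.proj (0, 2) +
            (u (1, 2) * u (3, 3) + u (1, 3) * u (3, 2)) • LinearMap.proj (0, 1))],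
      fun x hx => ?_⟩
    obtain ⟨a, p, q, rfl⟩ := hmem x hx
    refine ⟨(Matrix.of fun i j => u (i, j)).permanent, D1 u a p q, fun s => ?_⟩
    rw [eval_perPoly, Matrix.permanent_fin_four_row, Matrix.permanent_fin_four_row]
    simp only [D1, Fin.sum_univ_four, Matrix.cons_val_zero, Matrix.cons_val_one, Matrix.cons_val,
      LinearMap.add_apply, LinearMap.sub_apply, LinearMap.smul_apply, LinearMap.proj_apply,
      Matrix.permanent_fin_three_row, Matrix.of_apply, Matrix.submatrix_apply, Pi.add_apply,
      Pi.smul_apply, smul_eq_mul, e00, e01, e02, e10, e11, e12, e20, e21, e22, h00, h01,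
      h02, h03, h10, h11, h12, h13, h20, h21, h22, h23, h3]
    ring
  · -- per-direction family at `y = ψ (a, p, q)`: `q = u₃₃ w + v₃ n₃`
    obtain ⟨a, p, q, rfl⟩ := hmem x hx
    refine ⟨![4⁻¹, -4⁻¹, 4⁻¹, -4⁻¹],
      ![LinearMap.proj (3, 3) +
          ((p * a 2) • LinearMap.proj (2, 1) + (p * a 1) • LinearMap.proj (2, 2) +
            (q * a 2) • LinearMap.proj (1, 1) + (q * a 1) • LinearMap.proj (1, 2)),
        LinearMap.proj (3, 3) -
          ((p * a 2) • LinearMap.proj (2, 1) + (p * a 1) • LinearMap.proj (2, 2) +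
            (q * a 2) • LinearMap.proj (1, 1) + (q * a 1) • LinearMap.proj (1, 2)),
        (p • LinearMap.proj (2, 3) + q • LinearMap.proj (1, 3)) +
          (a 2 • LinearMap.proj (3, 1) + a 1 • LinearMap.proj (3, 2)),
        (p • LinearMap.proj (2, 3) + q • LinearMap.proj (1, 3)) -
          (a 2 • LinearMap.proj (3, 1) + a 1 • LinearMap.proj (3, 2))],
      fun u => ?_⟩
    refine ⟨(Matrix.of fun i j => u (i, j)).permanent, D1 u a p q, fun s => ?_⟩
    rw [eval_perPoly, Matrix.permanent_fin_four_row, Matrix.permanent_fin_four_row]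
    simp only [D1, Fin.sum_univ_four, Matrix.cons_val_zero, Matrix.cons_val_one, Matrix.cons_val,
      LinearMap.add_apply, LinearMap.sub_apply, LinearMap.smul_apply, LinearMap.proj_apply,
      Matrix.permanent_fin_three_row, Matrix.of_apply, Matrix.submatrix_apply, Pi.add_apply,
      Pi.smul_apply, smul_eq_mul, e00, e01, e02, e10, e11, e12, e20, e21, e22, h00, h01,
      h02, h03, h10, h11, h12, h13, h20, h21, h22, h23, h3]
    ring

/-- **The two-row-type `5`-space `V₅⁼ = span {E₀₀, E₀₁, E₀₂, E₁₀, E₁₁}`** is singular,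
`5`-dimensional, and carries per-base-point and per-direction families of four squares.
[folklore] -/
theorem exists_families_five_rows [CharZero K] :
    ∃ W : Submodule K (Fin 4 × Fin 4 → K),
      (∀ x ∈ W, ∀ (r c : Fin 3 → Fin 4), Function.Injective r → Function.Injective c →
        ((Matrix.of fun i j => x (i, j)).submatrix r c).permanent = 0) ∧
      finrank K W = 5 ∧
      (∀ u : Fin 4 × Fin 4 → K, ∃ (c : Fin 4 → K) (Λ : Fin 4 → ((Fin 4 × Fin 4 → K) →ₗ[K] K)),
        ∀ y ∈ W, ∃ e₀ e₁ : K, ∀ s : K,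
          eval (u + s • y) (perPoly (Fin 4) K) = e₀ + s * e₁ + s ^ 2 * ∑ k, c k * (Λ k y) ^ 2) ∧
      (∀ y ∈ W, ∃ (c : Fin 4 → K) (Λ : Fin 4 → ((Fin 4 × Fin 4 → K) →ₗ[K] K)),
        ∀ u : Fin 4 × Fin 4 → K, ∃ e₀ e₁ : K, ∀ s : K,
          eval (u + s • y) (perPoly (Fin 4) K) = e₀ + s * e₁ + s ^ 2 * ∑ k, c k * (Λ k u) ^ 2) := by
  classical
  have hcases : ∀ i : Fin 4, i = 0 ∨ i = 1 ∨ i = 2 ∨ i = 3 := by decide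
  -- the parametrisation `(a, b₀, b₁) ↦ (row 0 = (a 0, a 1, a 2, 0), row 1 = (b₀, b₁, 0, 0))`
  let F : (Fin 3 → K) × K × K → (Fin 4 × Fin 4 → K) := fun g z =>
    if z.1 = 0 then (if z.2 = 0 then g.1 0 else if z.2 = 1 then g.1 1 else if z.2 = 2 then g.1 2 else 0)
    else if z.1 = 1 then (if z.2 = 0 then g.2.1 else if z.2 = 1 then g.2.2 else 0)
    else 0
  have hF : ∀ g z, F g z =
    (if z.1 = 0 then (if z.2 = 0 then g.1 0 else if z.2 = 1 then g.1 1 else if z.2 = 2 then g.1 2 else 0)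
    else if z.1 = 1 then (if z.2 = 0 then g.2.1 else if z.2 = 1 then g.2.2 else 0)
    else 0) := fun _ _ => rfl
  let ψ : ((Fin 3 → K) × K × K) →ₗ[K] (Fin 4 × Fin 4 → K) :=
    { toFun := F
      map_add' := fun g g' => by
        funext z; simp only [hF, Prod.fst_add, Prod.snd_add, Pi.add_apply]
        split_ifs <;> ring
      map_smul' := fun r g => by
        funext z; simp only [hF, Prod.smul_fst, Prod.smul_snd, Pi.smul_apply, smul_eq_mul,
          RingHom.id_apply]
        split_ifs <;> ring }
  have hψ : ∀ (a : Fin 3 → K) (b₀ b₁ : K) (i j : Fin 4), ψ (a, b₀, b₁) (i, j) =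
      (if i = 0 then (if j = 0 then a 0 else if j = 1 then a 1 else if j = 2 then a 2 else 0)
        else if i = 1 then (if j = 0 then b₀ else if j = 1 then b₁ else 0) else 0) :=
    fun _ _ _ _ _ => rfl
  obtain ⟨f10, f20, f21, f30, f31, f32⟩ : (((1 : Fin 4) = 0) = False) ∧ (((2 : Fin 4) = 0) = False) ∧
      (((2 : Fin 4) = 1) = False) ∧ (((3 : Fin 4) = 0) = False) ∧ (((3 : Fin 4) = 1) = False) ∧
      (((3 : Fin 4) = 2) = False) := by
    refine ⟨?_, ?_, ?_, ?_, ?_, ?_⟩ <;> decide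
  have h00 : ∀ (a : Fin 3 → K) (b₀ b₁ : K), ψ (a, b₀, b₁) (0, 0) = a 0 := fun a b₀ b₁ => by
    rw [hψ]; simp
  have h01 : ∀ (a : Fin 3 → K) (b₀ b₁ : K), ψ (a, b₀, b₁) (0, 1) = a 1 := fun a b₀ b₁ => by
    rw [hψ]; simp [f10]
  have h02 : ∀ (a : Fin 3 → K) (b₀ b₁ : K), ψ (a, b₀, b₁) (0, 2) = a 2 := fun a b₀ b₁ => by
    rw [hψ]; simp [f20, f21]
  have h03 : ∀ (a : Fin 3 → K) (b₀ b₁ : K), ψ (a, b₀, b₁) (0, 3) = 0 := fun a b₀ b₁ => by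
    rw [hψ]; simp [f30, f31, f32]
  have h10 : ∀ (a : Fin 3 → K) (b₀ b₁ : K), ψ (a, b₀, b₁) (1, 0) = b₀ := fun a b₀ b₁ => by
    rw [hψ]; simp [f10]
  have h11 : ∀ (a : Fin 3 → K) (b₀ b₁ : K), ψ (a, b₀, b₁) (1, 1) = b₁ := fun a b₀ b₁ => by
    rw [hψ]; simp [f10]
  have h12 : ∀ (a : Fin 3 → K) (b₀ b₁ : K), ψ (a, b₀, b₁) (1, 2) = 0 := fun a b₀ b₁ => by
    rw [hψ]; simp [f10, f20, f21]
  have h13 : ∀ (a : Fin 3 → K) (b₀ b₁ : K), ψ (a, b₀, b₁) (1, 3) = 0 := fun a b₀ b₁ => by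
    rw [hψ]; simp [f10, f30, f31]
  have h2 : ∀ (a : Fin 3 → K) (b₀ b₁ : K) (j : Fin 4), ψ (a, b₀, b₁) (2, j) = 0 :=
    fun a b₀ b₁ j => by rw [hψ]; simp [f20, f21]
  have h3 : ∀ (a : Fin 3 → K) (b₀ b₁ : K) (j : Fin 4), ψ (a, b₀, b₁) (3, j) = 0 :=
    fun a b₀ b₁ j => by rw [hψ]; simp [f30, f31]
  let W : Submodule K (Fin 4 × Fin 4 → K) := LinearMap.range ψ
  have hmem : ∀ x ∈ W, ∃ (a : Fin 3 → K) (b₀ b₁ : K), x = ψ (a, b₀, b₁) := by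
    rintro _ ⟨⟨a, b₀, b₁⟩, rfl⟩
    exact ⟨a, b₀, b₁, rfl⟩
  -- `succAbove` on `Fin 4`
  obtain ⟨e00, e01, e02, e10, e11, e12, e20, e21, e22, e30, e31, e32⟩ :
      (0 : Fin 4).succAbove 0 = 1 ∧ (0 : Fin 4).succAbove 1 = 2 ∧ (0 : Fin 4).succAbove 2 = 3 ∧
      (1 : Fin 4).succAbove 0 = 0 ∧ (1 : Fin 4).succAbove 1 = 2 ∧ (1 : Fin 4).succAbove 2 = 3 ∧
      (2 : Fin 4).succAbove 0 = 0 ∧ (2 : Fin 4).succAbove 1 = 1 ∧ (2 : Fin 4).succAbove 2 = 3 ∧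
      (3 : Fin 4).succAbove 0 = 0 ∧ (3 : Fin 4).succAbove 1 = 1 ∧ (3 : Fin 4).succAbove 2 = 2 := by
    decide
  -- singular (two rows)
  have hSing : ∀ x ∈ W, ∀ (r c : Fin 3 → Fin 4), Function.Injective r → Function.Injective c →
      ((Matrix.of fun i j => x (i, j)).submatrix r c).permanent = 0 := by
    intro x hx
    obtain ⟨a, b₀, b₁, rfl⟩ := hmem x hx
    refine subperm_vanish_inj_of_succAbove _ fun r c => ?_
    rcases hcases r with rfl | rfl | rfl | rfl <;> rcases hcases c with rfl | rfl | rfl | rfl <;>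
      · simp only [Matrix.permanent_fin_three_row, Matrix.submatrix_apply, Matrix.of_apply,
          e00, e01, e02, e10, e11, e12, e20, e21, e22, e30, e31, e32,
          h00, h01, h02, h03, h10, h11, h12, h13, h2, h3]
        ring
  -- dimension `5`
  have hinj : Function.Injective ψ := by
    refine (injective_iff_map_eq_zero ψ).2 fun g hg => ?_
    obtain ⟨a, b₀, b₁⟩ := g
    have ha0 : a 0 = 0 := by have h := congr_fun hg (0, 0); rwa [h00] at h
    have ha1 : a 1 = 0 := by have h := congr_fun hg (0, 1); rwa [h01] at h
    have ha2 : a 2 = 0 := by have h := congr_fun hg (0, 2); rwa [h02] at h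
    have ha : a = 0 := by
      funext j
      rcases (by decide : ∀ j : Fin 3, j = 0 ∨ j = 1 ∨ j = 2) j with rfl | rfl | rfl <;> assumption
    have hb₀ : b₀ = 0 := by have h := congr_fun hg (1, 0); rwa [h10] at h
    have hb₁ : b₁ = 0 := by have h := congr_fun hg (1, 1); rwa [h11] at h
    rw [ha, hb₀, hb₁]; rfl
  have hW5 : finrank K W = 5 := by
    rw [LinearMap.finrank_range_of_inj hinj, Module.finrank_prod, Module.finrank_prod,
      finrank_fintype_fun_eq_card, Fintype.card_fin, Module.finrank_self]
  -- the `s¹`-coefficient (first-order term) along `y = ψ (a, b₀, b₁)`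
  let D1 : (Fin 4 × Fin 4 → K) → (Fin 3 → K) → K → K → K := fun u a p q =>
    a 0 * ((Matrix.of fun i j => u (i, j)).submatrix (0 : Fin 4).succAbove
        (0 : Fin 4).succAbove).permanent +
      a 1 * ((Matrix.of fun i j => u (i, j)).submatrix (0 : Fin 4).succAbove
        (1 : Fin 4).succAbove).permanent +
      a 2 * ((Matrix.of fun i j => u (i, j)).submatrix (0 : Fin 4).succAbove
        (2 : Fin 4).succAbove).permanent +
      p * ((Matrix.of fun i j => u (i, j)).submatrix (1 : Fin 4).succAbove
        (0 : Fin 4).succAbove).permanent +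
      q * ((Matrix.of fun i j => u (i, j)).submatrix (1 : Fin 4).succAbove
        (1 : Fin 4).succAbove).permanent
  refine ⟨W, hSing, hW5, fun u => ?_, fun x hx => ?_⟩
  · -- per-base-point family: `q = b₀ M₀(a) + b₁ M₁(a)`
    refine ⟨![4⁻¹, -4⁻¹, 4⁻¹, -4⁻¹],
      ![LinearMap.proj (1, 0) +
          ((u (2, 2) * u (3, 3) + u (2, 3) * u (3, 2)) • LinearMap.proj (0, 1) +
            (u (2, 1) * u (3, 3) + u (2, 3) * u (3, 1)) • LinearMap.proj (0, 2)),
        LinearMap.proj (1, 0) -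
          ((u (2, 2) * u (3, 3) + u (2, 3) * u (3, 2)) • LinearMap.proj (0, 1) +
            (u (2, 1) * u (3, 3) + u (2, 3) * u (3, 1)) • LinearMap.proj (0, 2)),
        LinearMap.proj (1, 1) +
          ((u (2, 2) * u (3, 3) + u (2, 3) * u (3, 2)) • LinearMap.proj (0, 0) +
            (u (2, 0) * u (3, 3) + u (2, 3) * u (3, 0)) • LinearMap.proj (0, 2)),
        LinearMap.proj (1, 1) -
          ((u (2, 2) * u (3, 3) + u (2, 3) * u (3, 2)) • LinearMap.proj (0, 0) +
            (u (2, 0) * u (3, 3) + u (2, 3) * u (3, 0)) • LinearMap.proj (0, 2))],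
      fun x hx => ?_⟩
    obtain ⟨a, b₀, b₁, rfl⟩ := hmem x hx
    refine ⟨(Matrix.of fun i j => u (i, j)).permanent, D1 u a b₀ b₁, fun s => ?_⟩
    rw [eval_perPoly, Matrix.permanent_fin_four_row, Matrix.permanent_fin_four_row]
    simp only [D1, Fin.sum_univ_four, Matrix.cons_val_zero, Matrix.cons_val_one, Matrix.cons_val,
      LinearMap.add_apply, LinearMap.sub_apply, LinearMap.smul_apply, LinearMap.proj_apply,
      Matrix.permanent_fin_three_row, Matrix.of_apply, Matrix.submatrix_apply, Pi.add_apply,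
      Pi.smul_apply, smul_eq_mul, e00, e01, e02, e10, e11, e12, e20, e21, e22, h00, h01,
      h02, h03, h10, h11, h12, h13, h2, h3]
    ring
  · -- per-direction family at `y = ψ (a, b₀, b₁)`: `q = u₃₃ (z · u₂) + u₂₃ (z · u₃)`
    obtain ⟨a, b₀, b₁, rfl⟩ := hmem x hx
    refine ⟨![4⁻¹, -4⁻¹, 4⁻¹, -4⁻¹],
      ![LinearMap.proj (3, 3) +
          ((a 2 * b₁) • LinearMap.proj (2, 0) + (a 2 * b₀) • LinearMap.proj (2, 1) +
            (a 0 * b₁ + a 1 * b₀) • LinearMap.proj (2, 2)),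
        LinearMap.proj (3, 3) -
          ((a 2 * b₁) • LinearMap.proj (2, 0) + (a 2 * b₀) • LinearMap.proj (2, 1) +
            (a 0 * b₁ + a 1 * b₀) • LinearMap.proj (2, 2)),
        LinearMap.proj (2, 3) +
          ((a 2 * b₁) • LinearMap.proj (3, 0) + (a 2 * b₀) • LinearMap.proj (3, 1) +
            (a 0 * b₁ + a 1 * b₀) • LinearMap.proj (3, 2)),
        LinearMap.proj (2, 3) -
          ((a 2 * b₁) • LinearMap.proj (3, 0) + (a 2 * b₀) • LinearMap.proj (3, 1) +
            (a 0 * b₁ + a 1 * b₀) • LinearMap.proj (3, 2))],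
      fun u => ?_⟩
    refine ⟨(Matrix.of fun i j => u (i, j)).permanent, D1 u a b₀ b₁, fun s => ?_⟩
    rw [eval_perPoly, Matrix.permanent_fin_four_row, Matrix.permanent_fin_four_row]
    simp only [D1, Fin.sum_univ_four, Matrix.cons_val_zero, Matrix.cons_val_one, Matrix.cons_val,
      LinearMap.add_apply, LinearMap.sub_apply, LinearMap.smul_apply, LinearMap.proj_apply,
      Matrix.permanent_fin_three_row, Matrix.of_apply, Matrix.submatrix_apply, Pi.add_apply,
      Pi.smul_apply, smul_eq_mul, e00, e01, e02, e10, e11, e12, e20, e21, e22, h00, h01,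
      h02, h03, h10, h11, h12, h13, h2, h3]
    ring

/-- **The dimension-`5` / four-square analogue of `false_of_families_six` is false**: there IS a
`5`-dimensional singular subspace of `per_4` carrying per-base-point and per-direction families
of four squares (`exists_families_five_cross`; also `exists_families_five_rows`). [folklore] -/
theorem not_false_of_families_five [CharZero K] :
    ¬ (∀ W : Submodule K (Fin 4 × Fin 4 → K),
      (∀ x ∈ W, ∀ (r c : Fin 3 → Fin 4), Function.Injective r → Function.Injective c →
        ((Matrix.of fun i j => x (i, j)).submatrix r c).permanent = 0) →
      finrank K W = 5 →
      (∀ u : Fin 4 × Fin 4 → K, ∃ (c : Fin 4 → K) (Λ : Fin 4 → ((Fin 4 × Fin 4 → K) →ₗ[K] K)),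
        ∀ y ∈ W, ∃ e₀ e₁ : K, ∀ s : K,
          eval (u + s • y) (perPoly (Fin 4) K) = e₀ + s * e₁ + s ^ 2 * ∑ k, c k * (Λ k y) ^ 2) →
      (∀ y ∈ W, ∃ (c : Fin 4 → K) (Λ : Fin 4 → ((Fin 4 × Fin 4 → K) →ₗ[K] K)),
        ∀ u : Fin 4 × Fin 4 → K, ∃ e₀ e₁ : K, ∀ s : K,
          eval (u + s • y) (perPoly (Fin 4) K) = e₀ + s * e₁ + s ^ 2 * ∑ k, c k * (Λ k u) ^ 2) →
      False) := by
  intro H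
  obtain ⟨W, hW3, h5, hW1, hW2⟩ := exists_families_five_cross (K := K)
  exact H W hW3 h5 hW1 hW2

end Summit.ValiantsHypothesis.ValiantsHypothesis.Theorems.SymPencilPerFourFiveDimFamilies

end
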